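import Literature.AlgebraicGeometry.Resolution.HasseSchmidtDiffEqDiffOp
import Mathlib.RingTheory.MvPolynomial.Basic
import Mathlib.Algebra.MvPolynomial.CommRing
import Mathlib.Algebra.Order.Antidiag.Finsupp
import HarnessLib

/-!
# Mizutani's conjecture `m(e) = 2p^e − 1` — the polynomial tower model, I: the ring and `(D^{(T)} ⊗ 1)`

Cell topic `Summits/ResolutionOfSingularities/KangarooAtlas` (pub-rosobs); namespace
`Summit.ResolutionOfSingularities.KangarooAtlas.Mizutani`.  Common vocabulary for
the Lean transcription of the in-house note MIZUTANI-PROOF-g59 (cell `pub-rosobs`; AI-written,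
AI-audited, NOT refereed by a human expert) on H. Mizutani's 1973 conjecture about the minimal
dimension of Hironaka's additive group schemes of exponent `≥ e`, relative to Oda's 1983
dictionary.  Nothing here is a resolution theorem.

## The model (MIZUTANI-PROOF-g59 §1; rational towers of §5)

For a tower `k = F(a_κ) ⊃ L` (`a_i^q ∈ L`, `q = p^e`) Oda's ring `R = k ⊗_L k` is `k[t]/(t_i^q)`,
`t_i = a_i ⊗ 1 − 1 ⊗ a_i`, with left `k`-basis `t^M`, `M ∈ [0, q−1]^ι` (Oda 1983-II p. 1166: "the
`(δa)^λ` form a basis").  An element `ω = Σ_M κ_M t^M` in NORMAL FORM (polynomial coefficients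
`κ_M ∈ F[a_κ]`, §5) is modelled as a `t`-polynomial over `MvPolynomial κ F`:

* `Rel ι κ F := MvPolynomial ι (MvPolynomial κ F)` — `t`-variables `ι`, `a`-variables `κ`, paired by
  an (injective) map `e : ι → κ` (`t_i = a_{e i} ⊗ 1 − 1 ⊗ a_{e i}`; `e = id` for the full tower, a
  proper inclusion for the sliced towers of §7, whose constant field contains the unpaired `a_k`);
  exponents outside the box are "zero in `R`" and are never read by the profile matrices (part II).
* `dtaylor e` — the DIAGONAL Taylor morphism `a_{e i} ↦ a_{e i} + u_i`, `t_i ↦ t_i + u_i` (other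
  `a_k` fixed): translating the LEFT tensor factor by `u` moves `a ⊗ 1` and `t` alike;
  `hsOp e T ω := coeff_{u^T} (dtaylor e ω)` is `(D^{(T)} ⊗ 1) ω`, the Hasse–Schmidt operator of the
  left factor (§1.4; EGA IV₄ 16.11.2), and **`hsOp_monomial`** is its value
  `(D^{(T)}⊗1)(κ t^M) = Σ_{T₁+T₂=T} C(M,T₂) · D^{(e_* T₁)}(κ) · t^{M−T₂}`; in particular
  `(D^{(T)}⊗1)(c t^N) = C(N,T) c t^{N−T}` for a constant `c` (§1.4 MONOMIALS, first step), and
  **`coeff_hsOp`** the resulting coefficient formula.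
* the exponent-vector vocabulary of §1.2/§4: `InBox`, `floorSum`, `IsGenuine`, `IsSplit`, `excess`,
  the multi-binomial `mchoose`.

`F` is any commutative ring here; characteristic `p` enters only where binomials are reduced
(later parts).  References: [Mizutani1973HironakaGroupSchemes] (Remark 2.10, the conjecture);
[Oda1983HironakaGroupSchemeII] (§1 p. 1166; Cor. 2.3, Thm. 3.1 = the dictionary);
[EGAIV4] Thm. 16.11.2 (the operators `D^{(T)}`).
-/

open MvPolynomial Literature.AlgebraicGeometry.Resolution

namespace Summit.ResolutionOfSingularities.KangarooAtlas.Mizutani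

/-! ## Exponent vectors: box, floor, genuine / split, multi-binomials -/

section Exponents

variable {ι : Type*}

/-- `M` lies in the box `[0, q−1]^ι` (the exponents of the left `k`-basis `t^M` of
`R = k[t]/(t^q)`). [cite: Oda1983HironakaGroupSchemeII, §1 (p. 1166: the (δa)^λ basis)] -/
def InBox (q : ℕ) (M : ι →₀ ℕ) : Prop := ∀ i, M i < q

/-- `floor(M) = Σ_i ⌊M_i / p⌋`; `t^M ∈ I_S = (t^p)^{q/p}` iff `floor(M) ≥ p^{e−1}`
(MIZUTANI-PROOF-g59 §1.2). [cite: Mizutani1973HironakaGroupSchemes, Remark 2.10 (in-house proof, §1.2)] -/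
def floorSum (p : ℕ) (M : ι →₀ ℕ) : ℕ := ∑ i ∈ M.support, M i / p

/-- A GENUINE box point: `|M| ≥ q = p^e` and `floor(M) ≤ p^{e−1} − 1`, i.e. `t^M ∈ J^q ∖ I_S`
(MIZUTANI-PROOF-g59 §1.2). [cite: Mizutani1973HironakaGroupSchemes, Remark 2.10 (in-house proof, §1.2)] -/
def IsGenuine (p e : ℕ) (M : ι →₀ ℕ) : Prop :=
  InBox (p ^ e) M ∧ p ^ e ≤ M.degree ∧ floorSum p M < p ^ (e - 1)

/-- A SPLIT box point: `|M| ≥ q` and `floor(M) ≥ p^{e−1}`, i.e. `t^M ∈ I_S`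
(MIZUTANI-PROOF-g59 §1.2). [cite: Mizutani1973HironakaGroupSchemes, Remark 2.10 (in-house proof, §1.2)] -/
def IsSplit (p e : ℕ) (M : ι →₀ ℕ) : Prop :=
  InBox (p ^ e) M ∧ p ^ e ≤ M.degree ∧ p ^ (e - 1) ≤ floorSum p M

/-- The EXCESS `c(M) = |M| − q` of a point (meaningful when `|M| ≥ q`; truncated otherwise)
(MIZUTANI-PROOF-g59 §1.2). [cite: Mizutani1973HironakaGroupSchemes, Remark 2.10 (in-house proof, §1.2)] -/
noncomputable def excess (q : ℕ) (M : ι →₀ ℕ) : ℕ := M.degree - q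

/-- `floor` as a sum over all indices. [folklore] -/
theorem floorSum_eq_sum [Fintype ι] (p : ℕ) (M : ι →₀ ℕ) : floorSum p M = ∑ i, M i / p := by
  unfold floorSum
  exact Finset.sum_subset (Finset.subset_univ _) fun i _ hi => by
    rw [Finsupp.notMem_support_iff.mp hi, Nat.zero_div]

/-- The multi-index binomial `C(N, T) = Π_i C(N_i, T_i)` (product over the support of `T`).
[folklore] -/
noncomputable def mchoose (N T : ι →₀ ℕ) : ℕ := ∏ i ∈ T.support, (N i).choose (T i)

/-- `C(N,T)` as a product over all indices. [folklore] -/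
theorem mchoose_eq_prod [Fintype ι] (N T : ι →₀ ℕ) : mchoose N T = ∏ i, (N i).choose (T i) := by
  unfold mchoose
  exact Finset.prod_subset (Finset.subset_univ _) fun i _ hi => by
    rw [Finsupp.notMem_support_iff.mp hi, Nat.choose_zero_right]

/-- `C(N,T) = 0` unless `T ≤ N`. [folklore] -/
theorem mchoose_eq_zero_of_not_le {N T : ι →₀ ℕ} (h : ¬ T ≤ N) : mchoose N T = 0 := by
  obtain ⟨j, hj⟩ : ∃ j, N j < T j := by
    by_contra hc
    push Not at hc
    exact h (Finsupp.le_def.mpr hc)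
  exact Finset.prod_eq_zero (Finsupp.mem_support_iff.mpr (by omega)) (Nat.choose_eq_zero_of_lt hj)

/-- `C(N,0) = 1`. [folklore] -/
@[simp] theorem mchoose_zero_right (N : ι →₀ ℕ) : mchoose N 0 = 1 := by
  simp [mchoose]

/-- `C(N,N) = 1`. [folklore] -/
@[simp] theorem mchoose_self (N : ι →₀ ℕ) : mchoose N N = 1 :=
  Finset.prod_eq_one fun _ _ => Nat.choose_self _

end Exponents

/-! ## The model ring and the diagonal Hasse–Schmidt operators `(D^{(T)} ⊗ 1)` -/

section Model

variable (ι κ F : Type*) [CommRing F]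

/-- The polynomial model of Oda's ring `R = k ⊗_L k = k[t]/(t^q)` for a rational tower:
`t`-polynomials (variables `ι`) with coefficients in `F[a_κ]`; `Σ_M κ_M t^M ↦` the `t`-polynomial
with coefficients `κ_M` (exponents outside the box are never read).
[cite: Oda1983HironakaGroupSchemeII, §1 (p. 1166: R with its left k-basis (δa)^λ)] -/
abbrev Rel := MvPolynomial ι (MvPolynomial κ F)

variable {ι κ F}
variable [Fintype ι] [DecidableEq κ] (e : ι → κ)

/-- The `u`-variables substituted for the `a`-variables: `a_k ↦ Σ_{e i = k} u_i` (`= u_i` if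
`k = e i` for an injective pairing, `= 0` off the image). [cite: EGAIV4, Thm. 16.11.2 (Taylor morphism)] -/
noncomputable def uOf (k : κ) : MvPolynomial ι (Rel ι κ F) :=
  ∑ i ∈ Finset.univ.filter (fun i => e i = k), X i

/-- `a_{e i} ↦ u_i` for an injective pairing. [cite: EGAIV4, Thm. 16.11.2 (Taylor morphism)] -/
theorem uOf_apply (he : Function.Injective e) (i : ι) : uOf (F := F) e (e i) = X i := by
  unfold uOf
  rw [Finset.sum_eq_single i]
  · intro j hj hji
    exact absurd (he (Finset.mem_filter.mp hj).2) hji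
  · intro h
    exfalso
    exact h (Finset.mem_filter.mpr ⟨Finset.mem_univ i, rfl⟩)

/-- `a_k ↦ 0` off the image of the pairing. [cite: EGAIV4, Thm. 16.11.2 (Taylor morphism)] -/
theorem uOf_of_notMem (k : κ) (hk : ∀ i, e i ≠ k) : uOf (F := F) e k = 0 :=
  Finset.sum_eq_zero fun i hi => absurd (Finset.mem_filter.mp hi).2 (hk i)

/-- Coefficient part of the diagonal Taylor morphism: `a_k ↦ a_k + Σ_{e i = k} u_i`, landing in the
`u`-polynomials over the model ring. [cite: EGAIV4, Thm. 16.11.2 (Taylor morphism and the D_p)] -/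
noncomputable def dtaylorCoeff : MvPolynomial κ F →+* MvPolynomial ι (Rel ι κ F) :=
  eval₂Hom (C.comp (C.comp C)) fun k => C (C (X k)) + uOf e k

/-- **The diagonal Taylor morphism** `ω(a, t) ↦ ω(a + u, t + u)` (`u` paired with `a` through `e`):
since `t = a ⊗ 1 − 1 ⊗ a`, translating the LEFT tensor factor by `u` moves both `a ⊗ 1` and `t`.
[cite: EGAIV4, Thm. 16.11.2 (Taylor morphism and the D_p)] -/
noncomputable def dtaylor : Rel ι κ F →+* MvPolynomial ι (Rel ι κ F) :=
  eval₂Hom (dtaylorCoeff e) fun i => C (X i) + X i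

/-- Constants are fixed by the diagonal Taylor morphism. [cite: EGAIV4, Thm. 16.11.2] -/
@[simp] theorem dtaylorCoeff_C (c : F) : dtaylorCoeff (ι := ι) e (C c) = C (C (C c)) := by
  simp [dtaylorCoeff]

/-- `a_k ↦ a_k + Σ_{e i = k} u_i`. [cite: EGAIV4, Thm. 16.11.2] -/
@[simp] theorem dtaylorCoeff_X (k : κ) :
    dtaylorCoeff (F := F) e (X k) = C (C (X k)) + uOf e k := by
  simp [dtaylorCoeff]

/-- On coefficients the diagonal Taylor morphism is `dtaylorCoeff`. [cite: EGAIV4, Thm. 16.11.2] -/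
@[simp] theorem dtaylor_C (κ₀ : MvPolynomial κ F) :
    dtaylor e (C κ₀ : Rel ι κ F) = dtaylorCoeff e κ₀ := by
  simp [dtaylor]

/-- `t_i ↦ t_i + u_i`. [cite: EGAIV4, Thm. 16.11.2] -/
@[simp] theorem dtaylor_X (i : ι) : dtaylor (F := F) (κ := κ) e (X i) = C (X i) + X i := by
  simp [dtaylor]

/-- The diagonal Taylor morphism through the ordinary one: `κ(a + u_e)` is `κ(a + v)`
(`HasseSchmidtDerivatives.taylor`) with `v_k ↦ Σ_{e i = k} u_i`. [cite: EGAIV4, Thm. 16.11.2] -/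
theorem dtaylorCoeff_eq_comp_taylor :
    dtaylorCoeff (F := F) e =
      (eval₂Hom (C.comp C) (uOf (F := F) e)).comp (taylor F (σ := κ)).toRingHom := by
  refine MvPolynomial.ringHom_ext (fun c => ?_) (fun k => ?_)
  · simp
  · simp [taylor_X]

/-- On `t`-monomials with coefficient `1` the diagonal Taylor morphism is the ordinary Taylor
morphism of `A[t]`. [cite: EGAIV4, Thm. 16.11.2] -/
theorem dtaylor_monomial_one (N : ι →₀ ℕ) :
    dtaylor (F := F) (κ := κ) e (monomial N 1) = taylor (MvPolynomial κ F) (monomial N 1) := by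
  rw [monomial_eq, C_1, one_mul, map_finsuppProd, map_finsuppProd]
  refine Finset.prod_congr rfl fun i _ => ?_
  simp only [map_pow, dtaylor_X, taylor_X]

/-- `dtaylor (κ t^N) = κ(a + u_e) · (t + u)^N`. [cite: EGAIV4, Thm. 16.11.2] -/
theorem dtaylor_monomial (N : ι →₀ ℕ) (κ₀ : MvPolynomial κ F) :
    dtaylor e (monomial N κ₀) =
      dtaylorCoeff e κ₀ * taylor (MvPolynomial κ F) (monomial N 1) := by
  rw [← mul_one κ₀, ← C_mul_monomial, map_mul, dtaylor_C, dtaylor_monomial_one, mul_one]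

/-- The `u`-monomials produced by the substitution `v_k ↦ Σ_{e i = k} u_i` (`e` injective):
`v^S ↦ u^{S'}` if `S = e_* S'`, and `↦ 0` if `S` involves a variable off the image of `e`.
[folklore] -/
theorem coeff_prod_uOf (he : Function.Injective e) (S : κ →₀ ℕ) (T : ι →₀ ℕ) :
    coeff T (S.prod fun k m => uOf (F := F) e k ^ m) = if S = T.mapDomain e then 1 else 0 := by
  classical
  by_cases hS : ∀ k ∈ S.support, k ∈ Set.range e
  · -- `S` is supported on the image: `S = e_* S'`
    let S' : ι →₀ ℕ := Finsupp.equivFunOnFinite.symm fun i => S (e i)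
    have hS' : S = S'.mapDomain e := by
      ext k
      by_cases hk : k ∈ Set.range e
      · obtain ⟨i, rfl⟩ := hk
        rw [Finsupp.mapDomain_apply he]
        simp [S']
      · rw [Finsupp.mapDomain_notin_range _ _ hk]
        by_contra h
        exact hk (hS k (Finsupp.mem_support_iff.mpr h))
    have hprod : (S.prod fun k m => uOf (F := F) e k ^ m) = monomial S' 1 := by
      rw [hS', Finsupp.prod_mapDomain_index_inj he, monomial_eq, C_1, one_mul]
      refine Finset.prod_congr rfl fun i _ => ?_
      simp only [uOf_apply e he]
    rw [hprod, coeff_monomial]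
    by_cases h : S' = T
    · rw [if_pos h, if_pos (by rw [hS', h])]
    · rw [if_neg h, if_neg]
      intro h'
      exact h (Finsupp.mapDomain_injective he (hS'.symm.trans h'))
  · -- a variable off the image kills the product
    push Not at hS
    obtain ⟨k, hk, hk'⟩ := hS
    have hz : (S.prod fun k m => uOf (F := F) e k ^ m) = 0 := by
      rw [Finsupp.prod]
      refine Finset.prod_eq_zero hk ?_
      rw [uOf_of_notMem e k fun i hi => hk' ⟨i, hi⟩, zero_pow (Finsupp.mem_support_iff.mp hk)]
    rw [hz, coeff_zero, if_neg]
    intro h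
    apply hk'
    by_contra hk''
    rw [h, Finsupp.mem_support_iff, Finsupp.mapDomain_notin_range _ _ hk''] at hk
    exact hk rfl

/-- **Coefficients of `κ(a + u_e)`**: the coefficient of `u^T` is `D^{(e_* T)} κ`, the Hasse–Schmidt
derivative of `κ ∈ F[a]` in the paired directions (`e` injective).
[cite: EGAIV4, Thm. 16.11.2 (D_p = coefficient of the Taylor morphism)] -/
theorem coeff_dtaylorCoeff (he : Function.Injective e) (κ₀ : MvPolynomial κ F) (T : ι →₀ ℕ) :
    coeff T (dtaylorCoeff e κ₀) = C (hasseDeriv F (T.mapDomain e) κ₀) := by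
  classical
  rw [dtaylorCoeff_eq_comp_taylor, RingHom.comp_apply, AlgHom.toRingHom_eq_coe, RingHom.coe_coe,
    (taylor F κ₀).as_sum, map_sum, coeff_sum]
  have hterm : ∀ S ∈ (taylor F κ₀).support,
      coeff T (eval₂Hom (C.comp C) (uOf (F := F) e) (monomial S (coeff S (taylor F κ₀)))) =
        if S = T.mapDomain e then C (hasseDeriv F (T.mapDomain e) κ₀) else 0 := by
    intro S _
    rw [eval₂Hom_monomial, RingHom.comp_apply, coeff_C_mul, coeff_prod_uOf e he]
    split_ifs with h
    · rw [mul_one, h, hasseDeriv_apply]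
    · rw [mul_zero]
  rw [Finset.sum_congr rfl hterm, Finset.sum_ite_eq']
  split_ifs with hmem
  · rfl
  · rw [notMem_support_iff] at hmem
    rw [hasseDeriv_apply, hmem, map_zero]

/-- **`(D^{(T)} ⊗ 1)`**, the Hasse–Schmidt operator of the left factor acting on the model ring:
the coefficient of `u^T` in `ω(a + u, t + u)` (MIZUTANI-PROOF-g59 §1.4; Oda's `Δ`-operators).
[cite: EGAIV4, Thm. 16.11.2 (D_p = coefficient of the Taylor morphism)] -/
noncomputable def hsOp (T : ι →₀ ℕ) (ω : Rel ι κ F) : Rel ι κ F := coeff T (dtaylor e ω)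

/-- `(D^{(T)}⊗1) ω = coeff_{u^T} ω(a + u, t + u)` (definitional). [cite: EGAIV4, Thm. 16.11.2] -/
theorem hsOp_apply (T : ι →₀ ℕ) (ω : Rel ι κ F) : hsOp e T ω = coeff T (dtaylor e ω) := rfl

/-- `(D^{(T)}⊗1)` is additive. [cite: EGAIV4, Thm. 16.11.2] -/
theorem hsOp_add (T : ι →₀ ℕ) (ω ω' : Rel ι κ F) :
    hsOp e T (ω + ω') = hsOp e T ω + hsOp e T ω' := by
  simp [hsOp]

/-- `(D^{(T)}⊗1)` commutes with finite sums. [cite: EGAIV4, Thm. 16.11.2] -/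
theorem hsOp_sum {α : Type*} (s : Finset α) (T : ι →₀ ℕ) (f : α → Rel ι κ F) :
    hsOp e T (∑ x ∈ s, f x) = ∑ x ∈ s, hsOp e T (f x) := by
  simp [hsOp, coeff_sum]

/-- `(D^{(T)}⊗1)` is `F`-linear. [cite: EGAIV4, Thm. 16.11.2] -/
theorem hsOp_C_mul (c : F) (T : ι →₀ ℕ) (ω : Rel ι κ F) :
    hsOp e T (C (C c) * ω) = C (C c) * hsOp e T ω := by
  simp [hsOp]

/-- `(D^{(T)}⊗1) 0 = 0`. [cite: EGAIV4, Thm. 16.11.2] -/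
@[simp] theorem hsOp_zero_right (T : ι →₀ ℕ) : hsOp e T (0 : Rel ι κ F) = 0 := by simp [hsOp]

variable [DecidableEq ι]

/-- **`(D^{(T)}⊗1)` on a monomial**:
`(D^{(T)}⊗1)(κ t^N) = Σ_{T₁+T₂=T} C(N,T₂) · D^{(e_* T₁)}(κ) · t^{N−T₂}` (MIZUTANI-PROOF-g59 §1.4;
`e` injective). [cite: EGAIV4, Thm. 16.11.2 (16.11.2.1)–(16.11.2.2)] -/
theorem hsOp_monomial (he : Function.Injective e) (T N : ι →₀ ℕ) (κ₀ : MvPolynomial κ F) :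
    hsOp e T (monomial N κ₀) =
      ∑ x ∈ Finset.antidiagonal T,
        monomial (N - x.2) ((mchoose N x.2 : MvPolynomial κ F) * hasseDeriv F (x.1.mapDomain e) κ₀) := by
  rw [hsOp_apply, dtaylor_monomial, coeff_mul]
  refine Finset.sum_congr rfl fun x _ => ?_
  rw [coeff_dtaylorCoeff e he, ← hasseDeriv_apply, hasseDeriv_monomial,
    ← map_natCast (C : MvPolynomial κ F →+* Rel ι κ F), ← mul_assoc, ← map_mul, C_mul_monomial,
    mul_one, mul_comm]
  rfl

/-- **MONOMIALS with constant coefficient** (MIZUTANI-PROOF-g59 §1.4): `(D^{(T)}⊗1)(c t^N) =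
C(N,T) c t^{N−T}` — all of `D^{(T)}` must fall on `t^N` because `D^{(T₁)} c = 0` for `T₁ ≠ 0`.
[cite: EGAIV4, Thm. 16.11.2 (16.11.2.1)] -/
theorem hsOp_monomial_C (he : Function.Injective e) (T N : ι →₀ ℕ) (c : F) :
    hsOp e T (monomial N (C c)) = monomial (N - T) (C ((mchoose N T : F) * c)) := by
  rw [hsOp_monomial e he, Finset.sum_eq_single ((0 : ι →₀ ℕ), T)]
  · simp only [Finsupp.mapDomain_zero, hasseDeriv_zero_apply]
    congr 1
    rw [map_mul, map_natCast]
  · intro x hx hne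
    rw [Finset.mem_antidiagonal] at hx
    have hx1 : x.1 ≠ 0 := by
      rintro h1
      apply hne
      rw [h1, zero_add] at hx
      exact Prod.ext h1 hx
    have hS : x.1.mapDomain e ≠ 0 := fun h =>
      hx1 (Finsupp.mapDomain_injective he (by rw [h, Finsupp.mapDomain_zero]))
    rw [hasseDeriv_apply, taylor_C, coeff_C, if_neg (fun h => hS h.symm), mul_zero, monomial_zero]
  · intro h
    exact absurd (Finset.mem_antidiagonal.mpr (zero_add T)) h

/-- `(D^{(0)} ⊗ 1) = id`. [cite: EGAIV4, Thm. 16.11.2 (D_0 = 1)] -/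
@[simp] theorem hsOp_zero (he : Function.Injective e) (ω : Rel ι κ F) : hsOp e 0 ω = ω := by
  induction ω using MvPolynomial.induction_on' with
  | monomial N κ₀ =>
    rw [hsOp_monomial e he, Finsupp.antidiagonal_zero, Finset.sum_singleton]
    simp
  | add f g hf hg => rw [hsOp_add, hf, hg]

/-- **Coefficients of `(D^{(T)}⊗1) ω`**:
`coeff_{t^M}((D^{(T)}⊗1)ω) = Σ_{T₁+T₂=T} C(M+T₂, T₂) · D^{(e_*T₁)}(coeff_{t^{M+T₂}} ω)`.
[cite: EGAIV4, Thm. 16.11.2 (16.11.2.1)–(16.11.2.2)] -/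
theorem coeff_hsOp (he : Function.Injective e) (T M : ι →₀ ℕ) (ω : Rel ι κ F) :
    coeff M (hsOp e T ω) =
      ∑ x ∈ Finset.antidiagonal T,
        (mchoose (M + x.2) x.2 : MvPolynomial κ F) *
          hasseDeriv F (x.1.mapDomain e) (coeff (M + x.2) ω) := by
  induction ω using MvPolynomial.induction_on' with
  | monomial N κ₀ =>
    rw [hsOp_monomial e he, coeff_sum]
    refine Finset.sum_congr rfl fun x _ => ?_
    rw [coeff_monomial, coeff_monomial]
    by_cases h : N = M + x.2
    · subst h
      rw [if_pos (add_tsub_cancel_right M x.2), if_pos rfl]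
    · rw [if_neg h, map_zero, mul_zero]
      split_ifs with h'
      · -- `N - T₂ = M` but `N ≠ M + T₂`: then `T₂ ≰ N` and the binomial vanishes
        have hnle : ¬ x.2 ≤ N := fun hle => h (by rw [← h', tsub_add_cancel_of_le hle])
        rw [mchoose_eq_zero_of_not_le hnle, Nat.cast_zero, zero_mul]
      · rfl
  | add f g hf hg =>
    rw [hsOp_add, coeff_add, hf, hg, ← Finset.sum_add_distrib]
    refine Finset.sum_congr rfl fun x _ => ?_
    rw [coeff_add, map_add, mul_add]

end Model

end Summit.ResolutionOfSingularities.KangarooAtlas.Mizutani
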